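import Mathlib
import HarnessLib
import Summits.HubbardSuperconductivity.HubbardSuperconductivity.Theorems.WeakCouplingBCSKlShellSliceTrig
import Summits.HubbardSuperconductivity.HubbardSuperconductivity.Theorems.WeakCouplingBCSKlShellVolumeSlices

/-!
# Route `WeakCouplingBCS` — certificate half of stmt-HubbardSuperconductivity-0158, item «(E2)-TPRIME-LINDHARD-BOUND» (pen (R460)(A)), (N2) = (SV) AT THE (δ) CELL:
# the shell volume `vol(BZ ∩ {|ε_{−3/10} − μ| < t}) ≤ C_sh·t` for `μ ∈ [−1, −9/10]` (⊃ the record's μ-box), TRANSVERSALITY-FREE (scope memo §9)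

Cell `gate-hubbard-kl`, seat p4 (g23); zero kit; no definitions.  `ε(x,y) = −2(cos x + cos y) + (6/5)cos x cos y` is symmetric in `(x, y)`, so the shell is covered by its two
halves `{|y| ≤ |x|}`, `{|x| ≤ |y|}`, and each half is sliced in its GOOD direction: at fixed `u` the slice `{v : |v| ≤ |u|, |ε(u,v) − μ| < t}` is EMPTY when `cos u ≥ 1/2`
(there `g(u) = −(μ + 2cos u)/(2 − (6/5)cos u) ≤ 0` while `cos v ≥ 1/2 > t/A`), and when `cos u ≤ 1/2` the slice function satisfies `|g(u)| ≤ 47/50`, so the full cosine-sublevel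
slice has length `≤ 2·(arccos (g − τ) − arccos (g + τ)) ≤ 4τ/√(1 − (19/20)²)` (`arccos_sub_arccos_le_div_sqrt`), `τ = t/A(u) ≤ (5/4)t`.  Hence
* **`kltp_shellVolume_m03`** — `volume (brillouinZone ∩ {p | |squareDispersion 1 (−3/10) p − μ| < t}) ≤ ENNReal.ofReal (4π · 5t/√(1 − (19/20)²))` for `μ ∈ [−1, −9/10]`,
  `0 < t ≤ 1/125` — the hypothesis `hSV` of `klg_memLp_kernel_of_geometry` at the (δ) cell for small `t` (large `t` is the trivial `vol BZ`).
Nothing here asserts (TSL), a chart, a record, a margin, `K₃`, `U₀`, the window or superconductivity.  [folklore]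
-/

noncomputable section

-- the tree's namespace `Summit.<Summit>.<Problem>.Theorems` repeats the summit name by design (D-0017)
set_option linter.dupNamespace false

namespace Summit.HubbardSuperconductivity.HubbardSuperconductivity.Theorems

open Real Set MeasureTheory MeasureTheory.Measure Literature.MathematicalPhysics.QuantumLattice
open scoped ENNReal

/-! ### §1 The good-direction slice bound -/

/-- The planar half-shell slice at abscissa `u`: `{v : |v| ≤ |u| ∧ v ∈ [−π, π) ∧ |ε(u,v) − μ| < t}`; its length is `≤ 4·(5t/4)/√(1 − (19/20)²)` for `μ ∈ [−1, −9/10]`,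
`0 < t ≤ 1/125` (empty if `cos u ≥ 1/2`; a cosine-sublevel slice with `|g| ≤ 47/50` otherwise). [folklore] -/
theorem kltp_m03_halfSlice_le {μ t : ℝ} (hμ1 : -1 ≤ μ) (hμ2 : μ ≤ -9 / 10) (ht0 : 0 < t) (ht1 : t ≤ 1 / 125) (u : ℝ) (hu : |u| ≤ π) :
    volume {v : ℝ | |v| ≤ |u| ∧ v ∈ Icc (-π) π ∧ |-2 * 1 * (cos u + cos v) - 4 * (-3 / 10) * cos u * cos v - μ| < t} ≤
      ENNReal.ofReal (4 * (5 / 4 * t) / Real.sqrt (1 - (19 / 20) ^ 2)) := by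
  set A : ℝ := 2 + 4 * (-3 / 10) * cos u with hA
  set g : ℝ := -(μ + 2 * cos u) / A with hg
  have hcu1 : cos u ≤ 1 := cos_le_one u
  have hcu2 : -1 ≤ cos u := neg_one_le_cos u
  have hA0 : 4 / 5 ≤ A := by rw [hA]; linarith
  have hApos : 0 < A := by linarith
  have hτ : t / A ≤ 5 / 4 * t := by
    rw [div_le_iff₀ hApos]; nlinarith
  -- the slice is a cosine-sublevel set: `|ε(u,v) − μ| = A·|cos v − g|`
  have hkey : ∀ v, |-2 * 1 * (cos u + cos v) - 4 * (-3 / 10) * cos u * cos v - μ| = A * |cos v - g| := by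
    intro v
    have : -2 * 1 * (cos u + cos v) - 4 * (-3 / 10) * cos u * cos v - μ = -(A * (cos v - g)) := by
      rw [hg, mul_sub, mul_div_cancel₀ _ hApos.ne', hA]; ring
    rw [this, abs_neg, abs_mul, abs_of_pos hApos]
  rcases le_or_gt (1 / 2) (cos u) with hcu | hcu
  · -- `cos u ≥ 1/2`: the half-slice is empty (`g ≤ 0`, `cos v ≥ cos u ≥ 1/2` on `|v| ≤ |u| ≤ π/3`-type range)
    have hg0 : g ≤ 0 := by
      rw [hg, div_le_iff₀ hApos, zero_mul]; linarith
    have hempty : {v : ℝ | |v| ≤ |u| ∧ v ∈ Icc (-π) π ∧ |-2 * 1 * (cos u + cos v) - 4 * (-3 / 10) * cos u * cos v - μ| < t} = ∅ := by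
      ext v
      simp only [mem_setOf_eq, mem_empty_iff_false, iff_false, not_and]
      intro hvu hvI h
      rw [hkey] at h
      -- `cos v ≥ cos u` since `|v| ≤ |u| ≤ π`
      have hcv : cos u ≤ cos v := by
        rw [← cos_abs u, ← cos_abs v]
        exact cos_le_cos_of_nonneg_of_le_pi (abs_nonneg v) hu hvu
      have h1 : 1 / 2 ≤ cos v - g := by linarith
      have h2 : A * |cos v - g| ≥ A * (1 / 2) := by
        rw [abs_of_nonneg (by linarith)]; exact mul_le_mul_of_nonneg_left h1 hApos.le
      linarith
    rw [hempty, measure_empty]; exact bot_le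
  · -- `cos u < 1/2`: `|g| ≤ 47/50`, full cosine-sublevel slice + Lipschitz bound
    have hgup : g ≤ 47 / 50 := by
      rw [hg, div_le_iff₀ hApos, hA]; nlinarith
    have hglo : -(47 / 50) ≤ g := by
      rw [hg, le_div_iff₀ hApos, hA]; nlinarith
    have hsub : {v : ℝ | |v| ≤ |u| ∧ v ∈ Icc (-π) π ∧ |-2 * 1 * (cos u + cos v) - 4 * (-3 / 10) * cos u * cos v - μ| < t} ⊆
        {v : ℝ | |cos v - g| < t / A} ∩ Icc (-π) π := by
      rintro v ⟨-, hvI, h⟩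
      refine ⟨?_, hvI⟩
      rw [mem_setOf_eq, lt_div_iff₀ hApos, mul_comm]; rwa [hkey] at h
    have hτ0 : 0 ≤ t / A := div_nonneg ht0.le hApos.le
    have hτ1 : t / A ≤ 1 / 100 := hτ.trans (by linarith)
    calc volume {v : ℝ | |v| ≤ |u| ∧ v ∈ Icc (-π) π ∧ |-2 * 1 * (cos u + cos v) - 4 * (-3 / 10) * cos u * cos v - μ| < t}
        ≤ volume ({v : ℝ | |cos v - g| < t / A} ∩ Icc (-π) π) := measure_mono hsub
      _ ≤ ENNReal.ofReal (2 * (arccos (g - t / A) - arccos (g + t / A))) := volume_abs_cos_sub_lt_inter_Icc_le _ _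
      _ ≤ ENNReal.ofReal (4 * (5 / 4 * t) / Real.sqrt (1 - (19 / 20) ^ 2)) := by
          refine ENNReal.ofReal_le_ofReal ?_
          have hL := arccos_sub_arccos_le_div_sqrt (m := 19 / 20) (a := g - t / A) (b := g + t / A) (by norm_num) (by norm_num)
            (by linarith) (by linarith) (by linarith)
          have hs0 : 0 < Real.sqrt (1 - (19 / 20 : ℝ) ^ 2) := Real.sqrt_pos.2 (by norm_num)
          rw [show g + t / A - (g - t / A) = 2 * (t / A) by ring] at hL
          calc 2 * (arccos (g - t / A) - arccos (g + t / A)) ≤ 2 * (2 * (t / A) / Real.sqrt (1 - (19 / 20) ^ 2)) := by linarith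
            _ = 4 * (t / A) / Real.sqrt (1 - (19 / 20) ^ 2) := by ring
            _ ≤ 4 * (5 / 4 * t) / Real.sqrt (1 - (19 / 20) ^ 2) := by gcongr

/-! ### §2 The shell volume at the (δ) cell -/

/-- **(SV) at the (δ) cell**: `vol(BZ ∩ {|ε_{−3/10} − μ| < t}) ≤ 4π·5t/√(1 − (19/20)²)` for `μ ∈ [−1, −9/10]`, `0 < t ≤ 1/125` (the two symmetric halves `{|y| ≤ |x|}`,
`{|x| ≤ |y|}`, each sliced in its good direction by `kltp_m03_halfSlice_le`). [folklore] -/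
theorem kltp_shellVolume_m03 {μ t : ℝ} (hμ1 : -1 ≤ μ) (hμ2 : μ ≤ -9 / 10) (ht0 : 0 < t) (ht1 : t ≤ 1 / 125) :
    volume (brillouinZone ∩ {p : Momentum | |squareDispersion 1 (-3 / 10) p - μ| < t}) ≤
      ENNReal.ofReal (4 * π * (5 * t) / Real.sqrt (1 - (19 / 20) ^ 2)) := by
  set T : Set (ℝ × ℝ) := {z : ℝ × ℝ | (z.1 ∈ Ico (-π) π ∧ z.2 ∈ Ico (-π) π) ∧
    |-2 * 1 * (Real.cos z.1 + Real.cos z.2) - 4 * (-3 / 10) * Real.cos z.1 * Real.cos z.2 - μ| < t} with hT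
  have hTm : MeasurableSet T := kltp_measurableSet_planarShell (-3 / 10) μ t
  have hH1m : MeasurableSet {z : ℝ × ℝ | |z.2| ≤ |z.1|} := measurableSet_le (by fun_prop) (by fun_prop)
  have hH2m : MeasurableSet {z : ℝ × ℝ | |z.1| ≤ |z.2|} := measurableSet_le (by fun_prop) (by fun_prop)
  rw [kltp_shell_eq_preimage, measurePreserving_momentum_prod.measure_preimage hTm.nullMeasurableSet]
  rw [show (volume : Measure (ℝ × ℝ)) = (volume : Measure ℝ).prod volume from rfl]
  have hcover : T ⊆ (T ∩ {z | |z.2| ≤ |z.1|}) ∪ (T ∩ {z | |z.1| ≤ |z.2|}) := fun z hz => by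
    rcases le_total |z.2| |z.1| with h | h
    · exact Or.inl ⟨hz, h⟩
    · exact Or.inr ⟨hz, h⟩
  set K : ℝ≥0∞ := ENNReal.ofReal (4 * (5 / 4 * t) / Real.sqrt (1 - (19 / 20) ^ 2)) with hK
  -- half 1: x-slices
  have h1 : ((volume : Measure ℝ).prod volume) (T ∩ {z | |z.2| ≤ |z.1|}) ≤ ∫⁻ x in Icc (-π) π, K := by
    rw [Measure.prod_apply (hTm.inter hH1m)]
    have hpt : ∀ x, volume (Prod.mk x ⁻¹' (T ∩ {z : ℝ × ℝ | |z.2| ≤ |z.1|})) ≤ (Icc (-π) π).indicator (fun _ => K) x := by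
      intro x
      by_cases hx : x ∈ Ico (-π) π
      · rw [indicator_of_mem (Ico_subset_Icc_self hx)]
        refine (measure_mono ?_).trans (kltp_m03_halfSlice_le hμ1 hμ2 ht0 ht1 x (abs_le.2 ⟨by linarith [hx.1], hx.2.le⟩))
        rintro v ⟨⟨⟨-, hv⟩, h⟩, hvu⟩
        exact ⟨hvu, Ico_subset_Icc_self hv, h⟩
      · have hempty : Prod.mk x ⁻¹' (T ∩ {z : ℝ × ℝ | |z.2| ≤ |z.1|}) = ∅ := by
          ext v; simp only [hT, mem_preimage, mem_inter_iff, mem_setOf_eq, mem_empty_iff_false, iff_false, not_and]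
          intro h; exact absurd h.1.1 hx
        rw [hempty, measure_empty]; exact bot_le
    calc ∫⁻ x, volume (Prod.mk x ⁻¹' (T ∩ {z : ℝ × ℝ | |z.2| ≤ |z.1|})) ≤ ∫⁻ x, (Icc (-π) π).indicator (fun _ => K) x := lintegral_mono hpt
      _ = ∫⁻ x in Icc (-π) π, K := lintegral_indicator measurableSet_Icc _
  -- half 2: y-slices (the same bound by the symmetry of `ε`)
  have h2 : ((volume : Measure ℝ).prod volume) (T ∩ {z | |z.1| ≤ |z.2|}) ≤ ∫⁻ y in Icc (-π) π, K := by
    rw [Measure.prod_apply_symm (hTm.inter hH2m)]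
    have hpt : ∀ y, volume ((fun x => (x, y)) ⁻¹' (T ∩ {z : ℝ × ℝ | |z.1| ≤ |z.2|})) ≤ (Icc (-π) π).indicator (fun _ => K) y := by
      intro y
      by_cases hy : y ∈ Ico (-π) π
      · rw [indicator_of_mem (Ico_subset_Icc_self hy)]
        refine (measure_mono ?_).trans (kltp_m03_halfSlice_le hμ1 hμ2 ht0 ht1 y (abs_le.2 ⟨by linarith [hy.1], hy.2.le⟩))
        rintro v ⟨⟨⟨hv, -⟩, h⟩, hvu⟩
        refine ⟨hvu, Ico_subset_Icc_self hv, ?_⟩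
        have : -2 * 1 * (cos y + cos v) - 4 * (-3 / 10) * cos y * cos v - μ = -2 * 1 * (cos v + cos y) - 4 * (-3 / 10) * cos v * cos y - μ := by ring
        rw [this]; exact h
      · have hempty : (fun x => (x, y)) ⁻¹' (T ∩ {z : ℝ × ℝ | |z.1| ≤ |z.2|}) = ∅ := by
          ext v; simp only [hT, mem_preimage, mem_inter_iff, mem_setOf_eq, mem_empty_iff_false, iff_false, not_and]
          intro h; exact absurd h.1.2 hy
        rw [hempty, measure_empty]; exact bot_le
    calc ∫⁻ y, volume ((fun x => (x, y)) ⁻¹' (T ∩ {z : ℝ × ℝ | |z.1| ≤ |z.2|})) ≤ ∫⁻ y, (Icc (-π) π).indicator (fun _ => K) y := lintegral_mono hpt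
      _ = ∫⁻ y in Icc (-π) π, K := lintegral_indicator measurableSet_Icc _
  have hconst : ∫⁻ _x in Icc (-π) π, K = K * ENNReal.ofReal (2 * π) := by
    rw [setLIntegral_const, Real.volume_Icc, show π - -π = 2 * π by ring, mul_comm]
  calc ((volume : Measure ℝ).prod volume) T ≤ ((volume : Measure ℝ).prod volume) ((T ∩ {z | |z.2| ≤ |z.1|}) ∪ (T ∩ {z | |z.1| ≤ |z.2|})) :=
        measure_mono hcover
    _ ≤ ((volume : Measure ℝ).prod volume) (T ∩ {z | |z.2| ≤ |z.1|}) + ((volume : Measure ℝ).prod volume) (T ∩ {z | |z.1| ≤ |z.2|}) :=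
        measure_union_le _ _
    _ ≤ K * ENNReal.ofReal (2 * π) + K * ENNReal.ofReal (2 * π) := by rw [← hconst]; exact add_le_add h1 h2
    _ = ENNReal.ofReal (4 * π * (5 * t) / Real.sqrt (1 - (19 / 20) ^ 2)) := by
        rw [hK, ← ENNReal.ofReal_mul (by positivity), ← ENNReal.ofReal_add (by positivity) (by positivity)]
        congr 1
        have hs : Real.sqrt (1 - (19 / 20 : ℝ) ^ 2) ≠ 0 := (Real.sqrt_pos.2 (by norm_num)).ne'
        field_simp
        ring

end Summit.HubbardSuperconductivity.HubbardSuperconductivity.Theorems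

end
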